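import Mathlib
import HarnessLib
import Summits.AtomisticToContinuum.Crystallization.Statement
import Summits.AtomisticToContinuum.Crystallization.Theses.HolmgrenBoyleLind
import Summits.AtomisticToContinuum.Crystallization.Theorems.HolmgrenBoyleLindHalfSpaceRigidityPeriodic
import Summits.AtomisticToContinuum.Crystallization.Theorems.HolmgrenBoyleLindFLCEquilibriumPeriodic
import Summits.AtomisticToContinuum.Crystallization.Theorems.HolmgrenBoyleLindHullBalance
import Summits.AtomisticToContinuum.Crystallization.Theorems.HolmgrenBoyleLindUCContinuum
import Summits.AtomisticToContinuum.Crystallization.Theorems.HolmgrenBoyleLindHalfSpaceUniqueContinuationRungsOfCores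

/-!
# Skeleton for crux `HalfSpaceUniqueContinuation` (item stmt-AtomisticToContinuum-6075), line
`registered` (birth: the PERIOD-RANK LADDER) — lead c3, v7 (cycle 3: the Fourier–Laplace peeling
machinery is in tree, INTERFACE RIGIDITY (first thin-column theorem) landed, thick-column rigidity
from ONE column written; the three registered stubs are unchanged)

The crux UC is, per FLC Delone Lennard-Jones equilibrium `Λ ⊂ ℝ³`, equivalent to "`Λ` is fully
periodic". The ladder (rank 0 ⇒ ≥ 1 ⇒ ≥ 2 ⇒ 3) is LANDED as
`Theorems.HolmgrenBoyleLind.stub_rungsOfCores : core₀ → core₁ → core₂ → FLCEquilibriumPeriodic`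
(p144051; soft geometry: periods pass to hull elements, sweeping, FLC dichotomy, `ℝ³` linear
algebra), where coreₖ = UC for `Λ` of period rank exactly `k` in the directions orthogonal to the
periods. Wave 1 (stub-workers on core₁, core₂) reduced both cores, sorry-free, to their
DISCRETE-TO-CONTINUUM content in PAIR form (no hull, no `Λ`): the signed Lennard-Jones field of the
symmetric difference of two FLC Delone equilibria with the common period(s), agreeing on an open
half-space whose normal is orthogonal to the period(s), vanishes on a non-empty OPEN subset of that
half-space — after which `UCContinuum` (`hbl_eq_of_diffField_eqOn_open`, landed) identifies the
pair. The registered stubs are therefore: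

* `stub_ucRank0` — UC (hull form) for `Λ` with NO non-zero period, all directions: the genuinely
  3-D core, no structure to exploit (lead);
* `stub_rodOpenVanishing` — rods: two `δ`-separated, `r`-dense, FLC, balanced sets with a common
  period `t ≠ 0`, agreeing on `{⟪z, u⟫ < a}` with `u ⊥ t` ⇒ open vanishing below (the rank-1
  UCDiscrete front: planar aperiodic geometry + one discrete Fourier index along `t`);
* `stub_layeredOpenVanishing` — layers: the same with two independent common periods `s, t ⊥ u`
  (the rank-2 front = polytype rigidity: `L`-periodic Laplace–Fourier modes in depth; closes on
  paper for the Barlow class via thick columns + transverse Blaschke + peeling; open corners: no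
  thick column (screw stackings), radial blindness).

Derived here (sorry-free): `ucRank1` ⇐ `stub_rodOpenVanishing`, `ucRank2` ⇐
`stub_layeredOpenVanishing` (hull transfer `hbl_hull_separated/dense/flc/balanced/period` +
`UCContinuum`), and `HalfSpaceUniqueContinuation_of` = converse glue ∘ ladder. Each stub is
implied by the crux (⟸ `FLCEquilibriumPeriodic`: two periodic crystals agreeing on a half-space are
equal) and none gives it alone (period hypotheses).

LANDED TOOLS AND CLOSED SUB-CLASSES (Theorems/HolmgrenBoyleLindHalfSpaceUniqueContinuation*.lean):
transverse Blaschke `hbl_inner_field_eq_zero_on_normal_ray` (p145655); thick normal lines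
`hbl_eq_of_thick_normal_lines`, grids `hbl_eq_of_agree_of_grid` (p147116); the local form
`hbl_iff_of_thick_normal_line` (p147571); the BARLOW CLASS of `stub_layeredOpenVanishing`:
`hbl_barlowStacking_eq_of_agree_below` (p147866: two balanced equal-spacing Barlow stackings
agreeing below a plane are equal — thick letter + thick-column argument, every `a, h > 0`) and
`hbl_barlowStacking_periodic_of_balanced` (every Barlow stacking in exact Lennard-Jones force
balance is periodic; symbolic input `hbl_hagg_exists_asymptotic_pair`, p147814).
CYCLE 2 (lead c2): rank-free `hbl_eq_of_recurrent_columns` + Bravais half-crystals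
`hbl_lattice_eq_of_registered_halfSpace` (p153094); finite registries `hbl_exists_thick_registry` +
`hbl_layered_eq_of_recurrent_registries` (p153758) — the thick-column world is closed in every rank.
The remaining case of all three stubs is THIN columns (registry drift). For `stub_layeredOpenVanishing`
the Fourier/peeling proof of the generic ("resolving observers") case has its analytic engine in tree:
`Literature.Analysis.Complex.ae_eq_zero_of_laplace_exp_decay` (p154524),
`eq_zero_of_generalDirichlet_hasSum_zero` (p155020),
`Literature.Analysis.Fourier.eq_zero_of_forall_sum_mul_cexp_eq_zero` (p155216), and LEMMA*
`Literature.Analysis.Complex.norm_le_exp_of_exp_decay_on_relDense` conditional on the named fact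
`Boas1954_thm_10_5_1` (Duffin–Schaeffer; p155732); missing bricks and the invisible-defect residual
are listed in `Cruxes/HalfSpaceUniqueContinuation/Lines/birth-frontier-c2.md`.
CYCLE 3 (lead c3; details and p-ids in `Lines/birth-frontier-c3.md`): the Duffin–Schaeffer-FREE
peeling machinery landed (Literature: lattice Poisson summation with the `dualVec` dictionary, power
kernel transforms and shell bounds, the Bessel–Laplace kernel measures with endpoint domination, the
signed-pair Laplace support lemma, general Dirichlet fibres, hedgehog moments via Lavrentiev;
Summits parts 11–20: layer slices/orbits/empty layers, shell and zero-mode Laplace forms, vertical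
and horizontal mode profiles, the normal-line MODE EXPANSION `hbl_signedField_hasSum_modes`, the
hedgehog core `hbl_fibres_eq_zero_of_modeMoments`, the shell-peeling core). Two new closed
sub-classes of `stub_layeredOpenVanishing`, both in pair form with `ω = ω'` as conclusion:
INTERFACE RIGIDITY `hbl_interface_rigidity` (p170449: no thick column at all — `ω` invariant below
the plane under `γ` with TOTALLY IRRATIONAL registry; corollary `hbl_lattice_eq_of_irrational_halfSpace`)
and THICK-COLUMN RIGIDITY `hbl_thickColumn_rigidity` (ONE thick column + generic layer lattice;
corollary `hbl_lattice_eq_of_generic_halfSpace`). Residual of the layered stub: partially rational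
registries / special layer lattices (the invisible-defect classes) and general FLC registry drift.
-/

namespace Summit.AtomisticToContinuum.Crystallization.Cruxes.HalfSpaceUniqueContinuation.Birth

open scoped BigOperators Topology InnerProductSpace
open Literature.MathematicalPhysics.StatisticalMechanics
open Summit.AtomisticToContinuum.Crystallization.Theses.HolmgrenBoyleLind
open Summit.AtomisticToContinuum.Crystallization.Theorems
open Summit.AtomisticToContinuum.Crystallization.Theorems.HolmgrenBoyleLind

/-! ## The registered stubs -/

/-- **UC core, rank 0 (totally aperiodic `Λ`, every direction).** For a `δ`-separated, `r`-dense,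
FLC subset of `ℝ³` in exact Lennard-Jones force balance WITHOUT non-zero periods, two patch-hull
elements agreeing on an open half-space coincide. The hardest stub: no period to quotient by. -/
theorem stub_ucRank0 :
    ∀ (Λ : Set (EuclideanSpace ℝ (Fin 3))) (δ r : ℝ), 0 < δ → 0 < r →
      (∀ x ∈ Λ, ∀ y ∈ Λ, x ≠ y → δ ≤ dist x y) →
      (∀ c : EuclideanSpace ℝ (Fin 3), ∃ y ∈ Λ, dist y c ≤ r) →
      (∀ R : ℝ, Set.Finite {S : Set (EuclideanSpace ℝ (Fin 3)) |
        ∃ x ∈ Λ, S = {v : EuclideanSpace ℝ (Fin 3) | x + v ∈ Λ ∧ ‖v‖ ≤ R}}) →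
      (∀ x ∈ Λ, HasSum (fun y : {y : EuclideanSpace ℝ (Fin 3) // y ∈ Λ ∧ y ≠ x} =>
        (deriv Literature.MathematicalPhysics.StatisticalMechanics.lennardJones
            (dist x (y : EuclideanSpace ℝ (Fin 3))) /
          dist x (y : EuclideanSpace ℝ (Fin 3))) • (x - (y : EuclideanSpace ℝ (Fin 3)))) 0) →
      (∀ t : EuclideanSpace ℝ (Fin 3), t ≠ 0 →
        ¬ (∀ x : EuclideanSpace ℝ (Fin 3), x + t ∈ Λ ↔ x ∈ Λ)) →
      ∀ ω ω' : Set (EuclideanSpace ℝ (Fin 3)),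
        (∀ R : ℝ, ∃ v : EuclideanSpace ℝ (Fin 3),
          {z : EuclideanSpace ℝ (Fin 3) | z ∈ ω ∧ ‖z‖ ≤ R} =
            {z : EuclideanSpace ℝ (Fin 3) | z + v ∈ Λ ∧ ‖z‖ ≤ R}) →
        (∀ R : ℝ, ∃ v : EuclideanSpace ℝ (Fin 3),
          {z : EuclideanSpace ℝ (Fin 3) | z ∈ ω' ∧ ‖z‖ ≤ R} =
            {z : EuclideanSpace ℝ (Fin 3) | z + v ∈ Λ ∧ ‖z‖ ≤ R}) →
        ∀ (u : EuclideanSpace ℝ (Fin 3)) (a : ℝ), u ≠ 0 →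
          (∀ z : EuclideanSpace ℝ (Fin 3), inner ℝ z u < a → (z ∈ ω ↔ z ∈ ω')) → ω = ω'  := by
  sorry

/-- **Rod open vanishing (rank-1 discrete-to-continuum front, pair form).** Two `δ`-separated,
`r`-dense, FLC subsets of `ℝ³` in exact Lennard-Jones force balance with a common period `t ≠ 0`,
agreeing on the open half-space `{⟪z, u⟫ < a}` with `u ⊥ t`, have a signed difference field
(`+` on `ω ∖ ω'`, `−` on `ω' ∖ ω`) vanishing on a non-empty open subset of that half-space. Known:
the field vanishes at every point of `ω` in the half-space (`hbl_diffField_eq_zero_on_halfSpace`)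
and along every thick normal ray (`hbl_inner_field_eq_zero_on_normal_ray`). -/
theorem stub_rodOpenVanishing :
    ∀ (ω ω' : Set (EuclideanSpace ℝ (Fin 3))) (δ r : ℝ), 0 < δ → 0 < r →
      (∀ x ∈ ω, ∀ y ∈ ω, x ≠ y → δ ≤ dist x y) →
      (∀ x ∈ ω', ∀ y ∈ ω', x ≠ y → δ ≤ dist x y) →
      (∀ c : EuclideanSpace ℝ (Fin 3), ∃ y ∈ ω, dist y c ≤ r) →
      (∀ c : EuclideanSpace ℝ (Fin 3), ∃ y ∈ ω', dist y c ≤ r) →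
      (∀ R : ℝ, Set.Finite {S : Set (EuclideanSpace ℝ (Fin 3)) |
        ∃ x ∈ ω, S = {v : EuclideanSpace ℝ (Fin 3) | x + v ∈ ω ∧ ‖v‖ ≤ R}}) →
      (∀ R : ℝ, Set.Finite {S : Set (EuclideanSpace ℝ (Fin 3)) |
        ∃ x ∈ ω', S = {v : EuclideanSpace ℝ (Fin 3) | x + v ∈ ω' ∧ ‖v‖ ≤ R}}) →
      (∀ x ∈ ω, HasSum (fun y : {y : EuclideanSpace ℝ (Fin 3) // y ∈ ω ∧ y ≠ x} =>
        (deriv Literature.MathematicalPhysics.StatisticalMechanics.lennardJones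
            (dist x (y : EuclideanSpace ℝ (Fin 3))) /
          dist x (y : EuclideanSpace ℝ (Fin 3))) • (x - (y : EuclideanSpace ℝ (Fin 3)))) 0) →
      (∀ x ∈ ω', HasSum (fun y : {y : EuclideanSpace ℝ (Fin 3) // y ∈ ω' ∧ y ≠ x} =>
        (deriv Literature.MathematicalPhysics.StatisticalMechanics.lennardJones
            (dist x (y : EuclideanSpace ℝ (Fin 3))) /
          dist x (y : EuclideanSpace ℝ (Fin 3))) • (x - (y : EuclideanSpace ℝ (Fin 3)))) 0) →
      ∀ t : EuclideanSpace ℝ (Fin 3), t ≠ 0 →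
        (∀ x : EuclideanSpace ℝ (Fin 3), x + t ∈ ω ↔ x ∈ ω) → (∀ x : EuclideanSpace ℝ (Fin 3), x + t ∈ ω' ↔ x ∈ ω') →
      ∀ (u : EuclideanSpace ℝ (Fin 3)) (a : ℝ), u ≠ 0 → inner ℝ t u = 0 →
      (∀ z : EuclideanSpace ℝ (Fin 3), inner ℝ z u < a → (z ∈ ω ↔ z ∈ ω')) →
      ∃ U₀ : Set (EuclideanSpace ℝ (Fin 3)), IsOpen U₀ ∧ U₀.Nonempty ∧ (∀ z ∈ U₀, inner ℝ z u < a) ∧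
        ∀ z ∈ U₀,
          (∑' y : {y : EuclideanSpace ℝ (Fin 3) // y ∈ ω ∧ y ∉ ω'},
              (deriv Literature.MathematicalPhysics.StatisticalMechanics.lennardJones (dist z y) / dist z y) •
                (z - (y : EuclideanSpace ℝ (Fin 3)))) -
            (∑' y : {y : EuclideanSpace ℝ (Fin 3) // y ∈ ω' ∧ y ∉ ω},
              (deriv Literature.MathematicalPhysics.StatisticalMechanics.lennardJones (dist z y) / dist z y) •
                (z - (y : EuclideanSpace ℝ (Fin 3)))) = 0 := by
  sorry

/-- **Layered open vanishing (rank-2 discrete-to-continuum front, pair form).** Two `δ`-separated,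
`r`-dense, FLC subsets of `ℝ³` in exact Lennard-Jones force balance with two common independent
periods `s, t`, agreeing on the open half-space `{⟪z, u⟫ < a}` with `u ⊥ s, t` (the stacking
direction), have a signed difference field vanishing on a non-empty open subset of that
half-space. Polytype rigidity in analytic form. -/
theorem stub_layeredOpenVanishing :
    ∀ (ω ω' : Set (EuclideanSpace ℝ (Fin 3))) (δ r : ℝ), 0 < δ → 0 < r →
      (∀ x ∈ ω, ∀ y ∈ ω, x ≠ y → δ ≤ dist x y) →
      (∀ x ∈ ω', ∀ y ∈ ω', x ≠ y → δ ≤ dist x y) →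
      (∀ c : EuclideanSpace ℝ (Fin 3), ∃ y ∈ ω, dist y c ≤ r) →
      (∀ c : EuclideanSpace ℝ (Fin 3), ∃ y ∈ ω', dist y c ≤ r) →
      (∀ R : ℝ, Set.Finite {S : Set (EuclideanSpace ℝ (Fin 3)) |
        ∃ x ∈ ω, S = {v : EuclideanSpace ℝ (Fin 3) | x + v ∈ ω ∧ ‖v‖ ≤ R}}) →
      (∀ R : ℝ, Set.Finite {S : Set (EuclideanSpace ℝ (Fin 3)) |
        ∃ x ∈ ω', S = {v : EuclideanSpace ℝ (Fin 3) | x + v ∈ ω' ∧ ‖v‖ ≤ R}}) →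
      (∀ x ∈ ω, HasSum (fun y : {y : EuclideanSpace ℝ (Fin 3) // y ∈ ω ∧ y ≠ x} =>
        (deriv Literature.MathematicalPhysics.StatisticalMechanics.lennardJones
            (dist x (y : EuclideanSpace ℝ (Fin 3))) /
          dist x (y : EuclideanSpace ℝ (Fin 3))) • (x - (y : EuclideanSpace ℝ (Fin 3)))) 0) →
      (∀ x ∈ ω', HasSum (fun y : {y : EuclideanSpace ℝ (Fin 3) // y ∈ ω' ∧ y ≠ x} =>
        (deriv Literature.MathematicalPhysics.StatisticalMechanics.lennardJones
            (dist x (y : EuclideanSpace ℝ (Fin 3))) /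
          dist x (y : EuclideanSpace ℝ (Fin 3))) • (x - (y : EuclideanSpace ℝ (Fin 3)))) 0) →
      ∀ s t : EuclideanSpace ℝ (Fin 3), t ≠ 0 →
        s ∉ Submodule.span ℝ ({t} : Set (EuclideanSpace ℝ (Fin 3))) →
        (∀ x : EuclideanSpace ℝ (Fin 3), x + t ∈ ω ↔ x ∈ ω) → (∀ x : EuclideanSpace ℝ (Fin 3), x + s ∈ ω ↔ x ∈ ω) →
        (∀ x : EuclideanSpace ℝ (Fin 3), x + t ∈ ω' ↔ x ∈ ω') → (∀ x : EuclideanSpace ℝ (Fin 3), x + s ∈ ω' ↔ x ∈ ω') →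
      ∀ (u : EuclideanSpace ℝ (Fin 3)) (a : ℝ), u ≠ 0 → inner ℝ s u = 0 → inner ℝ t u = 0 →
      (∀ z : EuclideanSpace ℝ (Fin 3), inner ℝ z u < a → (z ∈ ω ↔ z ∈ ω')) →
      ∃ U₀ : Set (EuclideanSpace ℝ (Fin 3)), IsOpen U₀ ∧ U₀.Nonempty ∧ (∀ z ∈ U₀, inner ℝ z u < a) ∧
        ∀ z ∈ U₀,
          (∑' y : {y : EuclideanSpace ℝ (Fin 3) // y ∈ ω ∧ y ∉ ω'},
              (deriv Literature.MathematicalPhysics.StatisticalMechanics.lennardJones (dist z y) / dist z y) •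
                (z - (y : EuclideanSpace ℝ (Fin 3)))) -
            (∑' y : {y : EuclideanSpace ℝ (Fin 3) // y ∈ ω' ∧ y ∉ ω},
              (deriv Literature.MathematicalPhysics.StatisticalMechanics.lennardJones (dist z y) / dist z y) •
                (z - (y : EuclideanSpace ℝ (Fin 3)))) = 0 := by
  sorry

/-! ## The cores of rank 1 and 2, derived from the open-vanishing stubs (sorry-free) -/

/-- **core₁ from `stub_rodOpenVanishing`**: transfer separation, density, FLC, balance and the
period `t` from `Λ` to the hull elements, take the open set from the stub, conclude by `UCContinuum`
(the open set avoids `ω ∆ ω'`, which lies in the closed complementary half-space). -/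
theorem ucRank1 :
    ∀ (Λ : Set (EuclideanSpace ℝ (Fin 3))) (δ r : ℝ), 0 < δ → 0 < r →
      (∀ x ∈ Λ, ∀ y ∈ Λ, x ≠ y → δ ≤ dist x y) →
      (∀ c : EuclideanSpace ℝ (Fin 3), ∃ y ∈ Λ, dist y c ≤ r) →
      (∀ R : ℝ, Set.Finite {S : Set (EuclideanSpace ℝ (Fin 3)) |
        ∃ x ∈ Λ, S = {v : EuclideanSpace ℝ (Fin 3) | x + v ∈ Λ ∧ ‖v‖ ≤ R}}) →
      (∀ x ∈ Λ, HasSum (fun y : {y : EuclideanSpace ℝ (Fin 3) // y ∈ Λ ∧ y ≠ x} =>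
        (deriv Literature.MathematicalPhysics.StatisticalMechanics.lennardJones
            (dist x (y : EuclideanSpace ℝ (Fin 3))) /
          dist x (y : EuclideanSpace ℝ (Fin 3))) • (x - (y : EuclideanSpace ℝ (Fin 3)))) 0) →
      ∀ t : EuclideanSpace ℝ (Fin 3), t ≠ 0 →
        (∀ x : EuclideanSpace ℝ (Fin 3), x + t ∈ Λ ↔ x ∈ Λ) →
        (∀ s : EuclideanSpace ℝ (Fin 3), (∀ x : EuclideanSpace ℝ (Fin 3), x + s ∈ Λ ↔ x ∈ Λ) →
          s ∈ Submodule.span ℝ ({t} : Set (EuclideanSpace ℝ (Fin 3)))) →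
      ∀ ω ω' : Set (EuclideanSpace ℝ (Fin 3)),
        (∀ R : ℝ, ∃ v : EuclideanSpace ℝ (Fin 3),
          {z : EuclideanSpace ℝ (Fin 3) | z ∈ ω ∧ ‖z‖ ≤ R} =
            {z : EuclideanSpace ℝ (Fin 3) | z + v ∈ Λ ∧ ‖z‖ ≤ R}) →
        (∀ R : ℝ, ∃ v : EuclideanSpace ℝ (Fin 3),
          {z : EuclideanSpace ℝ (Fin 3) | z ∈ ω' ∧ ‖z‖ ≤ R} =
            {z : EuclideanSpace ℝ (Fin 3) | z + v ∈ Λ ∧ ‖z‖ ≤ R}) →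
        ∀ (u : EuclideanSpace ℝ (Fin 3)) (a : ℝ), u ≠ 0 → inner ℝ t u = 0 →
          (∀ z : EuclideanSpace ℝ (Fin 3), inner ℝ z u < a → (z ∈ ω ↔ z ∈ ω')) → ω = ω'  := by
  intro Λ δ r hδ hr hsep hden hFLC hbal t ht0 ht _ ω ω' hω hω' u a hu htu hagree
  obtain ⟨U₀, hU₀, hne, hUhalf, hΦ⟩ := stub_rodOpenVanishing ω ω' δ r hδ hr
    (hbl_hull_separated hsep hω) (hbl_hull_separated hsep hω') (hbl_hull_dense hden hω)
    (hbl_hull_dense hden hω') (hbl_hull_flc hFLC hω) (hbl_hull_flc hFLC hω')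
    (hbl_hull_balanced hδ hsep hbal hω) (hbl_hull_balanced hδ hsep hbal hω') t ht0
    (hbl_hull_period ht hω) (hbl_hull_period ht hω') u a hu htu hagree
  refine hbl_eq_of_diffField_eqOn_open hδ (hbl_hull_separated hsep hω) (hbl_hull_separated hsep hω')
    hU₀ hne ?_ ?_ hΦ
  · rintro z hz ⟨hzω, hzω'⟩
    exact hzω' ((hagree z (hUhalf z hz)).1 hzω)
  · rintro z hz ⟨hzω', hzω⟩
    exact hzω ((hagree z (hUhalf z hz)).2 hzω')

/-- **core₂ from `stub_layeredOpenVanishing`**: the same transfer with both periods `s, t`. -/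
theorem ucRank2 :
    ∀ (Λ : Set (EuclideanSpace ℝ (Fin 3))) (δ r : ℝ), 0 < δ → 0 < r →
      (∀ x ∈ Λ, ∀ y ∈ Λ, x ≠ y → δ ≤ dist x y) →
      (∀ c : EuclideanSpace ℝ (Fin 3), ∃ y ∈ Λ, dist y c ≤ r) →
      (∀ R : ℝ, Set.Finite {S : Set (EuclideanSpace ℝ (Fin 3)) |
        ∃ x ∈ Λ, S = {v : EuclideanSpace ℝ (Fin 3) | x + v ∈ Λ ∧ ‖v‖ ≤ R}}) →
      (∀ x ∈ Λ, HasSum (fun y : {y : EuclideanSpace ℝ (Fin 3) // y ∈ Λ ∧ y ≠ x} =>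
        (deriv Literature.MathematicalPhysics.StatisticalMechanics.lennardJones
            (dist x (y : EuclideanSpace ℝ (Fin 3))) /
          dist x (y : EuclideanSpace ℝ (Fin 3))) • (x - (y : EuclideanSpace ℝ (Fin 3)))) 0) →
      ∀ s t : EuclideanSpace ℝ (Fin 3), t ≠ 0 →
        s ∉ Submodule.span ℝ ({t} : Set (EuclideanSpace ℝ (Fin 3))) →
        (∀ x : EuclideanSpace ℝ (Fin 3), x + t ∈ Λ ↔ x ∈ Λ) →
        (∀ x : EuclideanSpace ℝ (Fin 3), x + s ∈ Λ ↔ x ∈ Λ) →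
        (∀ w : EuclideanSpace ℝ (Fin 3), (∀ x : EuclideanSpace ℝ (Fin 3), x + w ∈ Λ ↔ x ∈ Λ) →
          w ∈ Submodule.span ℝ ({s, t} : Set (EuclideanSpace ℝ (Fin 3)))) →
      ∀ ω ω' : Set (EuclideanSpace ℝ (Fin 3)),
        (∀ R : ℝ, ∃ v : EuclideanSpace ℝ (Fin 3),
          {z : EuclideanSpace ℝ (Fin 3) | z ∈ ω ∧ ‖z‖ ≤ R} =
            {z : EuclideanSpace ℝ (Fin 3) | z + v ∈ Λ ∧ ‖z‖ ≤ R}) →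
        (∀ R : ℝ, ∃ v : EuclideanSpace ℝ (Fin 3),
          {z : EuclideanSpace ℝ (Fin 3) | z ∈ ω' ∧ ‖z‖ ≤ R} =
            {z : EuclideanSpace ℝ (Fin 3) | z + v ∈ Λ ∧ ‖z‖ ≤ R}) →
        ∀ (u : EuclideanSpace ℝ (Fin 3)) (a : ℝ), u ≠ 0 → inner ℝ s u = 0 → inner ℝ t u = 0 →
          (∀ z : EuclideanSpace ℝ (Fin 3), inner ℝ z u < a → (z ∈ ω ↔ z ∈ ω')) → ω = ω'  := by
  intro Λ δ r hδ hr hsep hden hFLC hbal s t ht0 hs ht hsper _ ω ω' hω hω' u a hu hsu htu hagree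
  obtain ⟨U₀, hU₀, hne, hUhalf, hΦ⟩ := stub_layeredOpenVanishing ω ω' δ r hδ hr
    (hbl_hull_separated hsep hω) (hbl_hull_separated hsep hω') (hbl_hull_dense hden hω)
    (hbl_hull_dense hden hω') (hbl_hull_flc hFLC hω) (hbl_hull_flc hFLC hω')
    (hbl_hull_balanced hδ hsep hbal hω) (hbl_hull_balanced hδ hsep hbal hω') s t ht0 hs
    (hbl_hull_period ht hω) (hbl_hull_period hsper hω) (hbl_hull_period ht hω')
    (hbl_hull_period hsper hω') u a hu hsu htu hagree
  refine hbl_eq_of_diffField_eqOn_open hδ (hbl_hull_separated hsep hω) (hbl_hull_separated hsep hω')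
    hU₀ hne ?_ ?_ hΦ
  · rintro z hz ⟨hzω, hzω'⟩
    exact hzω' ((hagree z (hUhalf z hz)).1 hzω)
  · rintro z hz ⟨hzω', hzω⟩
    exact hzω ((hagree z (hUhalf z hz)).2 hzω')

/-! ## The skeleton theorem -/

/-- **The crux BY NAME from the registered stubs**: the landed ladder `stub_rungsOfCores` turns
core₀ (`stub_ucRank0`), core₁ (`ucRank1`), core₂ (`ucRank2`) into `FLCEquilibriumPeriodic`, and the
landed converse glue `halfSpaceUniqueContinuation_of_flcEquilibriumPeriodic` gives
`HalfSpaceUniqueContinuation`. -/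
theorem HalfSpaceUniqueContinuation_of : HalfSpaceUniqueContinuation :=
  halfSpaceUniqueContinuation_of_flcEquilibriumPeriodic
    (Summit.AtomisticToContinuum.Crystallization.Theorems.HolmgrenBoyleLind.stub_rungsOfCores
      stub_ucRank0 ucRank1 ucRank2)

end Summit.AtomisticToContinuum.Crystallization.Cruxes.HalfSpaceUniqueContinuation.Birth
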